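import Summits.BirchSwinnertonDyer.BirchSwinnertonDyer.Theorems.SemiOrdinaryEisensteinDescentWildSplitEisensteinInclusionAtThreeReplacesToricWall
import Summits.BirchSwinnertonDyer.BirchSwinnertonDyer.Theorems.UniversalToricDescentToricKernelAtThree
import HarnessLib

/-!
# Crux E `WildSplitEisensteinInclusionAtThree` (stmt-BirchSwinnertonDyer-20479): UTD's registered twin leaf
# `WAllExclAddWildRankOneSurjTwin` from SOED's E in place of UTD's wall S_div (20395) — companion of
# `…ReplacesToricWall.lean` (cell `pub/bsd-wall`, width seat `bsd-wall-soed-p1-w3` g0, `--supports 20479`, helper)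

Kept in its own file because it must import UTD's landed kernel module
`UniversalToricDescentToricKernelAtThree` (p533077), which lies in UTD's `Theses` cone (lint `theses-cone`);
the route-light glue `toricTransportModThree_of_wildSplitEisensteinInclusionAtThree` (E → 20399 → 20400 → 20186)
lives in the companion.

* `wAllExclAddWildRankOneSurjTwin_of_wildSplitEisensteinInclusionAtThree` — `ToricPublishedInputs` → E (SOED
  20479) → `InvariantsTransportModThree` (UTD 20399) → `TwinMuZeroAtThree` (20400) → `TwinSplitIMCAtThree` (20214) →
  `WildSplitWaldspurgerAtThree` (20385) → `WildSplitControlAtThree` (20386) → `WildRankZeroTwistAtThree` (20387) →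
  `Summit.BirchSwinnertonDyer.WAllExclAddWildRankOneSurjTwin` (W-ALL/2@3.O6.r1.twin), by UTD's deciding theorem
  `closes` with the companion's §2 for crux #2 `ToricTransportModThree` and the landed kernel
  `universalToricDescent_toricKernelAtThree_proof`. READING: for UTD's leaf the two research walls S_div (UTD,
  «⊇») and E (SOED, «⊆») are INTERCHANGEABLE modulo the transport items 20399/20400.

HONEST STATUS: every research input is an antecedent; nothing is proved about E; BSD is not proved for any
curve. No definition, no named fact, no `sorry`. Supports, does not close, stmt-BirchSwinnertonDyer-20479.

References: [JetchevSkinnerWan2017] §7.4 (the two halves of the assembly); [GreenbergVatsal2000] Thm. 1.4.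
-/

set_option autoImplicit false
set_option linter.dupNamespace false

noncomputable section

namespace Summit.BirchSwinnertonDyer.BirchSwinnertonDyer.Theorems.WildSplitEisensteinInclusionAtThreeReplacesToricWall

open Summit.BirchSwinnertonDyer.BirchSwinnertonDyer.Theorems
  Summit.BirchSwinnertonDyer.BirchSwinnertonDyer.Theses

/-- **UTD's registered leaf from SOED's E in place of UTD's wall.** `ToricPublishedInputs` → E (SOED 20479) →
`InvariantsTransportModThree` (20399) → `TwinMuZeroAtThree` (20400) → `TwinSplitIMCAtThree` (20214) →
`WildSplitWaldspurgerAtThree` (20385) → `WildSplitControlAtThree` (20386) → `WildRankZeroTwistAtThree` (20387) →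
`Summit.BirchSwinnertonDyer.WAllExclAddWildRankOneSurjTwin` (W-ALL/2@3.O6.r1.twin): UTD's deciding theorem
`closes` with `toricTransportModThree_of_wildSplitEisensteinInclusionAtThree` for crux #2 and the landed kernel
`universalToricDescent_toricKernelAtThree_proof` (p533077). For UTD's leaf the research walls S_div (UTD 20395,
«⊇») and E (SOED 20479, «⊆») are interchangeable modulo 20399/20400. BSD is not proved by this: every research
input is an antecedent. [cite: JetchevSkinnerWan2017, §7.4 (the two halves of the assembly)] -/
theorem wAllExclAddWildRankOneSurjTwin_of_wildSplitEisensteinInclusionAtThree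
    (hF : UniversalToricDescent.ToricPublishedInputs)
    (hE : SemiOrdinaryEisensteinDescent.WildSplitEisensteinInclusionAtThree)
    (hinv : UniversalToricDescent.InvariantsTransportModThree)
    (hμ : UniversalToricDescent.TwinMuZeroAtThree)
    (hI : UniversalToricDescent.TwinSplitIMCAtThree)
    (hV : UniversalToricDescent.WildSplitWaldspurgerAtThree)
    (hC : UniversalToricDescent.WildSplitControlAtThree)
    (hZ : UniversalToricDescent.WildRankZeroTwistAtThree) :
    Summit.BirchSwinnertonDyer.WAllExclAddWildRankOneSurjTwin :=
  -- (buildfix 2026-08-28) UTD's `closes` was re-keyed (rev ≥ 12: ToricDefectWallMuAtThree / …OfPrint binders); this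
  -- accepted statement keeps the rev-11 items, so the pre-edit chain of `closes` is inlined: the landed kernel
  -- `universalToricDescent_toricKernelAtThree_proof` fed with the six rev-11 inputs, then `…SurjTwin_of_forall`.
  Summit.BirchSwinnertonDyer.wAllExclAddWildRankOneSurjTwin_of_forall
    (universalToricDescent_toricKernelAtThree_proof hF
      (toricTransportModThree_of_wildSplitEisensteinInclusionAtThree hE hinv hμ) hI hV hC hZ)

end Summit.BirchSwinnertonDyer.BirchSwinnertonDyer.Theorems.WildSplitEisensteinInclusionAtThreeReplacesToricWall

end
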